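import Summits.QuantumFields.BalabanUV.Beta.FP.TowerDoorGaugePeriodised
import Summits.QuantumFields.BalabanUV.Beta.FP.TowerDoorRecordThetaGS
import Summits.QuantumFields.BalabanUV.Beta.NVertexChartSymLetters

/-!
# `BalabanUV.Beta.FP.TowerDoorGaugePeriodisedGS` — binder row D1 ∕ (C1), STUB P (P-c) AT THE L-CHART: **THE L DOOR's TREE-GAUGE FUNCTION OF A SINGLE TOP SOURCE IS THE
# `Mc`-PERIODISATION OF THE L LATTICE GAUGE FUNCTION `λℤ` at `scaleK σ σ (ANs ρ Ψ̂ˢ (n+1))`** — PART 57 `TowerDoorGaugePeriodised` §Record with the ONE chart token changed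
# `AN R ↦ ANs R Ψ̂ˢ` (its generic §Assembly `lv_smul_single_eq_tsum_lamZ` is chart-parametric and REUSED by name; the two chart facts it asks — `Lc^(n+2)`-block covariance (hA) and
# summable source copies (hAs) — are supplied at the L-chart from `NVertexChartSymLetters.shiftK_ANs_sym` and gen-94 `TowerDoorRecordThetaGS.summable_scaleK_ANs_inl_inr_sources`)
# (β-function cell `pub-balaban`, BINDER-OWNERS row D1 ∕ (C1) OWNER «beta-an2» gen 95; director-ym g24 [DIRYM-G24-INBOX-7] (3) «`hWΔT` BY NAME»: the (T2) letter `hWΔT_recGS`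
# (gen-95 `TowerDoorRecordPeriodisedGS`) displays `hlv` at `lamRecGS`; this file and its companion `TowerDoorRecordGaugeLetterGS` make that display a THEOREM from S-END-G's own binders,
# exactly as PART 57∕77 did for v10's `hWΔT_rec` at the rooted record chart).

WHAT ([folklore] BY NAME; no `def`, no `def … : Prop`, nothing cited, 0 sorry):
§1 `shiftK_scaleK_ANs` (the `σ`-conjugated L-chart is `Lc^(j+1)`-block covariant), `summable_scaleK_ANs_inl_inr_copies`;
§2 **`lv_smul_single_eq_tsum_lamZ_at_pins_symL`** — PART 57 `lv_smul_single_eq_tsum_lamZ_at_pins` with the leg letters `hEAN hLN` and the conclusion read at `scaleK σ σ (ANs R Ψ̂ˢ (n+1))`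
(S-END-G's `hEAN hLN` display), every other binder (v10's sym pins `hH₀ hQ₁₀ hτ₁ hτ₂ hQ₂₀ hW₀ hP h𝔔₀ hI hS hhv hXN`, `h1 h2 hTW`, `hMc`, the slot pin `hfa`, v10's `hlve`) CHARACTER FOR CHARACTER;
conclusion `lv (c • Pi.single a 1) s = c * Σ'_m lamZ Lc lev ρc∗ ρc∈ n (scaleK σ σ (ANs R Ψ̂ˢ (n+1))) μ (translate Mc w m) ↑s`; proof = PART 57's (road g53 (D) `gaugeParam_eq_neg_nestedReadout_sym`,
PART 55 G-2 `det_refSlice_mul_towerGen_ne_zero`, §Assembly) with §1 feeding (hA)(hAs).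
WHAT THIS IS NOT: `h1 h2 hTW` are NOT discharged here (displayed, as in PART 57; PART 77's wrapper feeds `h1` from `hXF` and `hTW` from leaf-06); no display of S-END-G is discharged; the END is NOT
instantiated; ZERO weight on `hlawLG` (THE CRUX — OPEN by name) ∕ `hG` ∕ `hF₁` ∕ (J-m2)″; nothing of Bałaban's asserted, valued or discharged; 0 estimates; 0∕4 row-D1 binders (hW, hR, D1Tel, D1Rep);
S-END-G ✓ p830965 and suppliers UNTOUCHED; ROOT M‴ p325680 ∕ P5c ∕ D6 untouched; NOT (C1), NOT (T-ID), NOT D1, NEVER «G-an2-4 closed», NOT BetaPertH, NOT continuum, NOT Clay.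

HONEST DEPENDENCY (page 1, mandatory): continuum YM on T⁴ ⇐ BetaPertH ∧ nine spine estimates (0/9 proved); BetaPertH ⇐ (D1) ∧ (D4) ∧ CAP+tail;
G-an2-4 gates asym, D1 and NE2/3/4.  HONEST FRAMING (cell contract, verbatim): «discharging `BetaPertH` makes Bałaban's UV stability UNCONDITIONAL —
a real constructive-QFT result; it is NOT the continuum limit and NOT the Clay problem.»  ABSOLUTE RULE (cell charter, verbatim): «No internally-minted
statement may enter as a cited fact. Every hypothesis is either kernel-proved in this package or a verbatim quotation of a PUBLISHED theorem with page
reference. The manuscript(s) under audit are NOT citable for their own disputed steps — they are the thing under adjudication; programme-internal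
(2001/route/tribunal) claims are never citable.»  Row D1 ∕ (C1) OWNER «beta-an2» gen 95, 2026-08-31.  No existing file touched.
-/

noncomputable section

open Finset Matrix
open scoped BigOperators
open Literature.Probability.LatticeModels (Torus.proj)
open Literature.MathematicalPhysics.QuantumFieldTheory
open Literature.MathematicalPhysics.QuantumFieldTheory.Balaban1983to89
open Literature.MathematicalPhysics.QuantumFieldTheory.Balaban1983to89.Beta
open Literature.MathematicalPhysics.QuantumFieldTheory.Balaban1983to89.Beta.Composition (kkt)
open Literature.MathematicalPhysics.QuantumFieldTheory.Balaban1983to89.Beta.CompositionSingular (effForm minOp)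
open B4TorusKernel.MultiPeriod (translate translate_injective)
open B4Reflection242 (translate_translate)
open B5Prop11Plancherel (fine)
open B6Lemma24Torus (pbox wrap)
open AffineAveraging (Site box toSite unitVec)
open AveragingContoursRooted (ctrOff ctrOff_mem_box)
open OneStepResolventKernel (Fib)
open ExpKernelCalculus (MKer shiftK)
open HessKerRate (scaleK scaleK_apply)
open Literature.MathematicalPhysics.QuantumFieldTheory.LatticeForm (quo)
open Summit.QuantumFields.BalabanUV.Beta.AxialDressingRooted (axEc)
open Summit.QuantumFields.BalabanUV.Beta.SymShiftedSpread (bhKStepSh)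
open Summit.QuantumFields.BalabanUV.Beta.DshAn1 (Dsh)
open Summit.QuantumFields.BalabanUV.Beta.CompositeOneShotJetData (Roots)
open Summit.QuantumFields.BalabanUV.Beta.CompositeCorrectorKernelSym (psiKSym)
open Summit.QuantumFields.BalabanUV.Beta.FP.CompositeOneShotJetDataSym (ANs)
open Summit.QuantumFields.BalabanUV.Beta.FP.StepRecursionSymEnd (ΨL)
open Summit.QuantumFields.BalabanUV.Beta.NVertexChartSymLetters (shiftK_ANs_sym)
open Summit.QuantumFields.BalabanUV.Beta.FP.KernelPeriodisationFib (Idx perF perZ perF_apply perZ_apply)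
open Summit.QuantumFields.BalabanUV.Beta.FP.TorusGaugeCovariancePairing (wrapPt wrapPt_coe)
open Summit.QuantumFields.BalabanUV.Beta.FP.TorusCombRows (Res)
open Summit.QuantumFields.BalabanUV.Beta.FP.TorusCompositeObjects (towerTorus towerTorus_apply NParam combF bigP towerGen bigRoot bigRatio bigRatio_eq_pow towerEquiv)
open Summit.QuantumFields.BalabanUV.Beta.FP.TorusCompositeObjectsG (compRowsSym)
open Summit.QuantumFields.BalabanUV.Beta.FP.TorusCompositeUnimodular (towerEvalC)
open Summit.QuantumFields.BalabanUV.Beta.GAN24.FineReadoutCauchyFrame (toSite_mem_range)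
open Summit.QuantumFields.BalabanUV.Beta.FP.TowerDoorRecordThetaGS (ΨL_eq summable_scaleK_ANs_inl_inr_sources)
open Summit.QuantumFields.BalabanUV.Beta.FP.TorusNestedGaugeReadout (gaugeParam_eq_neg_nestedReadout_sym)
open Summit.QuantumFields.BalabanUV.Beta.FP.TowerDoorGaugeRefDefs
open Summit.QuantumFields.BalabanUV.Beta.FP.TowerDoorGaugePeriodised (lv_smul_single_eq_tsum_lamZ)

namespace Summit.QuantumFields.BalabanUV.Beta.FP.TowerDoorGaugePeriodisedGS

/-! ## §1–§2 At S-END-G's pins, for the L-chart `σ·ANs·σ`: block covariance and summability discharged, then STUB P (P-c) -/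

section Record

variable {Lc : ℕ} [NeZero Lc] (R : Roots Lc)

/-- [folklore] **the `σ`-conjugated L-chart at door index `j` is `Lc^(j+1)`-block covariant** (`NVertexChartSymLetters.shiftK_ANs_sym` at S-L3b's corrector family `ΨL R` (`ΨL_eq`, `rfl`);
`scaleK` is by constants) — PART 57 `shiftK_scaleK_AN` at `ANs`. -/
theorem shiftK_scaleK_ANs (j : ℕ) (u v : Fib 3 → ℝ) (t : Site (3 + 1)) :
    shiftK (-(((Lc ^ (j + 1) : ℕ) : ℤ) • t)) (scaleK u v (ANs R (ΨL R) j)) = scaleK u v (ANs R (ΨL R) j) := by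
  rw [ΨL_eq]
  have h := shiftK_ANs_sym R j t
  funext x y a b
  simp only [shiftK, scaleK_apply] at h ⊢
  rw [show ANs R (fun m => psiKSym R.rc Lc m) j (x + -(((Lc ^ (j + 1) : ℕ) : ℤ) • t)) (y + -(((Lc ^ (j + 1) : ℕ) : ℤ) • t)) a b
      = ANs R (fun m => psiKSym R.rc Lc m) j x y a b from
    congrFun (congrFun (congrFun (congrFun h x) y) a) b]

/-- [folklore] the source copies of the `σ`-conjugated L-chart's field–multiplier columns are summable (gen-94 `TowerDoorRecordThetaGS.summable_scaleK_ANs_inl_inr_sources` over all coarse sites ∘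
`Summable.comp_injective` along `m ↦ translate Mc w m`) — PART 57 `summable_scaleK_AN_inl_inr_copies` at `ANs`. -/
theorem summable_scaleK_ANs_inl_inr_copies (j : ℕ) (u v : Fib 3 → ℝ) (Mc : Fin (3 + 1) → ℕ) [∀ i, NeZero (Mc i)]
    (x : Site (3 + 1)) (κ μ : Fin (3 + 1)) (w : Site (3 + 1)) :
    Summable (fun m : Site (3 + 1) => scaleK u v (ANs R (ΨL R) j) x (((Lc ^ (j + 1) : ℕ) : ℤ) • translate Mc w m) (Sum.inl κ) (Sum.inr μ)) :=
  (summable_scaleK_ANs_inl_inr_sources R j u v x κ μ).comp_injective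
    (translate_injective (N := Mc) (fun i => Nat.one_le_iff_ne_zero.mpr (NeZero.ne (Mc i))) w)

variable (M' : Fin (3 + 1) → ℕ) [∀ μ, NeZero (M' μ)] (Lc) (lev : ℕ → ℕ) (n : ℕ)

set_option synthInstance.maxSize 1024 in
/-- [folklore] **`lv_smul_single_eq_tsum_lamZ_at_pins_symL` — STUB P (P-c) AT S-END-G's PINS, L-CHART: THE L DOOR's TREE-GAUGE FUNCTION IS THE PERIODISED L LATTICE GAUGE FUNCTION** — PART 57
`lv_smul_single_eq_tsum_lamZ_at_pins` with the leg letters `hEAN hLN` and the conclusion read at `scaleK σ σ (ANs R Ψ̂ˢ (n+1))` (as S-END-G ✓ p830965 displays `hEAN hLN`), everything else CHARACTER FOR CHARACTER.  Binders = road g53 (D)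
`gaugeParam_eq_neg_nestedReadout_sym`'s VERBATIM (`d = 3`) + leaf-06 G-2's `det ≠ 0` on the box + the leg letters `hEAN hLN` for the record's chart `scaleK σ σ (ANs R Ψ̂ˢ (n+1))` + the coarse box `Mc` (`M′ = Lc • Mc`,
`hMc`) + ONE slot pin `hfa : fN a = (wrapPt T (L • w), inr μ)` (v10: `hfN n B a`, `w = ↑a.1`, `μ = a.2`) + v10's `hlve` display; conclusion:
`lv (c • Pi.single a 1) s = c * Σ'_m lamZ Lc lev ρc∗ ρc∈ n (scaleK σ σ (ANs R Ψ̂ˢ (n+1))) μ (translate Mc w m) ↑s` — G-2 on the reference tower is PART 55 `det_refSlice_mul_towerGen_ne_zero` (no hypothesis). -/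
theorem lv_smul_single_eq_tsum_lamZ_at_pins_symL
    (hrs : ∀ _k : ℕ, ctrOff (3 + 1) Lc ∈ box (3 + 1) Lc)
    (hlev : ∀ i, i ≤ n → lev i = lev (i + 1) + 1) (hM' : ∀ i, Lc ∣ M' i)
    {κ : Type*} [Fintype κ] [DecidableEq κ] (pμ' : κ → ↥(pbox M')) (mμ' : κ → Fin (3 + 1))
    (hfμ' : Function.Injective (fun a : κ => ((pμ' a, Sum.inr (mμ' a)) : Idx M' (Fib 3))))
    (hcoarse' : ∀ (s : ↥(pbox M')) (m : Fin (3 + 1)),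
      ((s, Sum.inr m) : Idx M' (Fib 3)) ∈ Set.range (fun a : κ => ((pμ' a, Sum.inr (mμ' a)) : Idx M' (Fib 3))) ↔ Torus.proj Lc (s : Site (3 + 1)) = 0)
    {H₀ : Matrix (↥(pbox (towerTorus Lc M' (n + 1))) × Fin (3 + 1)) (↥(pbox (towerTorus Lc M' (n + 1))) × Fin (3 + 1)) ℝ}
    {Q₁₀ : Matrix (↥(pbox M') × Fin (3 + 1)) (↥(pbox (towerTorus Lc M' (n + 1))) × Fin (3 + 1)) ℝ}
    {τ₁ : Matrix (NParam Lc (fine Lc M') (fun k => (fun _ : ℕ => ctrOff (3 + 1) Lc) (k + 1)) n) (↥(pbox (towerTorus Lc M' (n + 1))) × Fin (3 + 1)) ℝ}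
    (hH₀ : H₀ = (perF (towerTorus Lc M' (n + 1)) (bhKStepSh 3 Lc (Dsh Lc) (lev (n + 1)))).submatrix
        (fun b : ↥(pbox (towerTorus Lc M' (n + 1))) × Fin (3 + 1) => ((b.1, Sum.inl b.2) : Idx (towerTorus Lc M' (n + 1)) (Fib 3)))
        (fun b : ↥(pbox (towerTorus Lc M' (n + 1))) × Fin (3 + 1) => ((b.1, Sum.inl b.2) : Idx (towerTorus Lc M' (n + 1)) (Fib 3))))
    (hQ₁₀ : Q₁₀ = compRowsSym Lc M' lev (fun _ : ℕ => ctrOff (3 + 1) Lc) (n + 1))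
    (hτ₁ : τ₁ = bigP Lc (fine Lc M') (fun k => (fun _ : ℕ => ctrOff (3 + 1) Lc) (k + 1)) (fun k => toSite_mem_range (hrs (k + 1))) n)
    {τ₂ : Matrix (Res (toSite (ctrOff (3 + 1) Lc)) Lc M') (↥(pbox M') × Fin (3 + 1)) ℝ} (hτ₂ : τ₂ = combF Lc M' ((fun _ : ℕ => ctrOff (3 + 1) Lc) 0))
    {Q₂₀ : Matrix κ (↥(pbox M') × Fin (3 + 1)) ℝ}
    (hQ₂₀ : Q₂₀ = (perF M' (bhKStepSh 3 Lc (Dsh Lc) (lev 0))).submatrix (fun a : κ => ((pμ' a, Sum.inr (mμ' a)) : Idx M' (Fib 3)))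
        (fun b : ↥(pbox M') × Fin (3 + 1) => ((b.1, Sum.inl b.2) : Idx M' (Fib 3))))
    {W₀ : Matrix (↥(pbox (towerTorus Lc M' (n + 1))) × Fin (3 + 1)) (NParam Lc M' (fun _ : ℕ => ctrOff (3 + 1) Lc) (n + 1)) ℝ}
    (hW₀ : W₀ = towerGen Lc M' (fun _ : ℕ => ctrOff (3 + 1) Lc) (n + 1))
    {P : Matrix (NParam Lc M' (fun _ : ℕ => ctrOff (3 + 1) Lc) (n + 1)) (↥(pbox (towerTorus Lc M' (n + 1))) × Fin (3 + 1)) ℝ}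
    (hP : P = bigP Lc M' (fun _ : ℕ => ctrOff (3 + 1) Lc) (fun k => toSite_mem_range (hrs k)) (n + 1))
    {𝔔₀ : Matrix κ (↥(pbox (towerTorus Lc M' (n + 1))) × Fin (3 + 1)) ℝ} (h𝔔₀ : Q₂₀ * Q₁₀ = 𝔔₀)
    {I : Matrix (↥(pbox (towerTorus Lc M' (n + 1))) × Fin (3 + 1))
      ((↥(pbox M') × Fin (3 + 1)) ⊕ NParam Lc (fine Lc M') (fun k => (fun _ : ℕ => ctrOff (3 + 1) Lc) (k + 1)) n) ℝ}
    {S : Matrix ((↥(pbox M') × Fin (3 + 1)) ⊕ NParam Lc (fine Lc M') (fun k => (fun _ : ℕ => ctrOff (3 + 1) Lc) (k + 1)) n)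
      ((↥(pbox M') × Fin (3 + 1)) ⊕ NParam Lc (fine Lc M') (fun k => (fun _ : ℕ => ctrOff (3 + 1) Lc) (k + 1)) n) ℝ}
    (hI : minOp H₀ (fromRows Q₁₀ τ₁) = I) (hS : effForm H₀ (fromRows Q₁₀ τ₁) = S)
    {hv : (κ → ℝ) → ((↥(pbox (towerTorus Lc M' (n + 1))) × Fin (3 + 1)) → ℝ)}
    (hhv : ∀ v, hv v = I *ᵥ Sum.elim (minOp S.toBlocks₁₁ (fromRows Q₂₀ τ₂) *ᵥ Sum.elim v 0) 0)
    {XN : Matrix ((↥(pbox (towerTorus Lc M' (n + 1))) × Fin (3 + 1)) ⊕ (κ ⊕ NParam Lc M' (fun _ : ℕ => ctrOff (3 + 1) Lc) (n + 1)))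
      ((↥(pbox (towerTorus Lc M' (n + 1))) × Fin (3 + 1)) ⊕ (κ ⊕ NParam Lc M' (fun _ : ℕ => ctrOff (3 + 1) Lc) (n + 1))) ℝ}
    (hXN : kkt H₀ (fromRows 𝔔₀ P) * XN = 1) 
    -- the two KKT non-degeneracies of the NESTED system (displayed; at the wrapper `h1` is `Matrix.isUnit_det_of_right_inverse` on the F leg `hXF`, `h2` is #21-GB's (EFF) line)
    (h1 : (kkt H₀ (fromRows Q₁₀ τ₁)).det ≠ 0) (h2 : (kkt S.toBlocks₁₁ (fromRows Q₂₀ τ₂)).det ≠ 0)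
    (hTW : (Matrix.fromRows (τ₂ * Q₁₀) τ₁ * W₀).det ≠ 0)
    -- the coarse box and the leg letters for the record's chart
    (Mc : Fin (3 + 1) → ℕ) [∀ i, NeZero (Mc i)] (hMc : ∀ i, M' i = Lc * Mc i)
    (σ : Fib 3 → ℝ) (ρN : Site (3 + 1)) (LNc : ℕ) (fN : κ → Idx (towerTorus Lc M' (n + 1)) (Fib 3))
    (hEAN : perF (towerTorus Lc M' (n + 1)) (axEc ρN LNc) * perF (towerTorus Lc M' (n + 1)) (scaleK σ σ (ANs R (ΨL R) (n + 1))) = perF (towerTorus Lc M' (n + 1)) (scaleK σ σ (ANs R (ΨL R) (n + 1))))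
    (hLN : XN.submatrix (Sum.map id Sum.inl) (Sum.map id Sum.inl) = fromBlocks
      (Matrix.of fun (b b' : (↥(pbox (towerTorus Lc M' (n + 1))) × Fin (3 + 1))) =>
        axEc ρN LNc (b.1 : Site (3 + 1)) (b.1 : Site (3 + 1)) (Sum.inl b.2) (Sum.inl b.2)
          * (axEc ρN LNc (b'.1 : Site (3 + 1)) (b'.1 : Site (3 + 1)) (Sum.inl b'.2) (Sum.inl b'.2)
            * perF (towerTorus Lc M' (n + 1)) (scaleK σ σ (ANs R (ΨL R) (n + 1))) (b.1, Sum.inl b.2) (b'.1, Sum.inl b'.2)))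
      (Matrix.of fun (b : (↥(pbox (towerTorus Lc M' (n + 1))) × Fin (3 + 1))) (a : κ) =>
        axEc ρN LNc (b.1 : Site (3 + 1)) (b.1 : Site (3 + 1)) (Sum.inl b.2) (Sum.inl b.2) * perF (towerTorus Lc M' (n + 1)) (scaleK σ σ (ANs R (ΨL R) (n + 1))) (b.1, Sum.inl b.2) (fN a))
      (-Matrix.of fun (a : κ) (b : (↥(pbox (towerTorus Lc M' (n + 1))) × Fin (3 + 1))) =>
        axEc ρN LNc (b.1 : Site (3 + 1)) (b.1 : Site (3 + 1)) (Sum.inl b.2) (Sum.inl b.2) * perF (towerTorus Lc M' (n + 1)) (scaleK σ σ (ANs R (ΨL R) (n + 1))) (fN a) (b.1, Sum.inl b.2))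
      (-((perF (towerTorus Lc M' (n + 1)) (scaleK σ σ (ANs R (ΨL R) (n + 1)))).submatrix fN fN)))
    -- ONE slot pin (v10: `hfN n B a` with `w = ↑a.1`, `μ = a.2`)
    (a : κ) (w : Site (3 + 1)) (μ : Fin (3 + 1))
    (hfa : fN a = (wrapPt (towerTorus Lc M' (n + 1)) (((Lc ^ (n + 1 + 1) : ℕ) : ℤ) • w), Sum.inr μ)) (c : ℝ)
    -- v10's `hlve`-shaped DISPLAY of the tree-gauge function
    (lv : (κ → ℝ) → (↥(pbox (towerTorus Lc M' (n + 1))) → ℝ))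
    (hlve : ∀ (v : κ → ℝ) (s : ↥(pbox (towerTorus Lc M' (n + 1)))), lv v s
      = -(∑ x : Res (bigRoot Lc (fun _ : ℕ => ctrOff (3 + 1) Lc) (n + 1)) (bigRatio Lc (n + 1)) (towerTorus Lc M' (n + 1)),
          (if (x.1 : ↥(pbox (towerTorus Lc M' (n + 1)))) = s then
            (towerEvalC Lc M' (fun _ : ℕ => ctrOff (3 + 1) Lc) (fun k => toSite_mem_range (hrs k)) (n + 1)
              *ᵥ ((P * W₀)⁻¹ *ᵥ (P *ᵥ hv v))) (towerEquiv Lc M' (fun _ : ℕ => ctrOff (3 + 1) Lc) (fun k => toSite_mem_range (hrs k)) (n + 1) x) else 0)))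
    (s : ↥(pbox (towerTorus Lc M' (n + 1)))) :
    lv (c • (Pi.single a (1 : ℝ) : κ → ℝ)) s
      = c * ∑' m : Site (3 + 1), lamZ Lc lev (fun _ : ℕ => ctrOff (3 + 1) Lc) (fun k => toSite_mem_range (hrs k)) n (scaleK σ σ (ANs R (ΨL R) (n + 1))) μ
          (translate Mc w m) (s : Site (3 + 1)) := by
  have hθ := gaugeParam_eq_neg_nestedReadout_sym M' Lc lev n hrs hlev hM' pμ' mμ' hfμ' hcoarse' hH₀ hQ₁₀ hτ₁ hτ₂ hQ₂₀ hW₀ hP h𝔔₀ hI hS hhv hXN h1 h2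
    (c • (Pi.single a (1 : ℝ) : κ → ℝ))
  have hLb : ((bigRatio Lc (n + 1) : ℕ) : ℤ) = ((Lc ^ (n + 1 + 1) : ℕ) : ℤ) := by rw [bigRatio_eq_pow]
  have hA : ∀ t : Site (3 + 1), shiftK (-(((bigRatio Lc (n + 1) : ℕ) : ℤ) • t)) (scaleK σ σ (ANs R (ΨL R) (n + 1))) = scaleK σ σ (ANs R (ΨL R) (n + 1)) := fun t => by
    rw [hLb]; exact shiftK_scaleK_ANs R (n + 1) σ σ t
  have hAs : ∀ (x : Site (3 + 1)) (κ' μ' : Fin (3 + 1)) (w' : Site (3 + 1)),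
      Summable (fun m : Site (3 + 1) => scaleK σ σ (ANs R (ΨL R) (n + 1)) x (((bigRatio Lc (n + 1) : ℕ) : ℤ) • translate Mc w' m) (Sum.inl κ') (Sum.inr μ')) :=
    fun x κ' μ' w' => by rw [hLb]; exact summable_scaleK_ANs_inl_inr_copies R (n + 1) σ σ Mc x κ' μ' w'
  have hfa' : fN a = (wrapPt (towerTorus Lc M' (n + 1)) (((bigRatio Lc (n + 1) : ℕ) : ℤ) • w), Sum.inr μ) := by rw [hLb]; exact hfa
  exact lv_smul_single_eq_tsum_lamZ Lc M' lev (fun _ : ℕ => ctrOff (3 + 1) Lc) (fun k => toSite_mem_range (hrs k)) hM' n hQ₁₀ hτ₁ hτ₂ rfl hW₀ hTW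
    (det_refSlice_mul_towerGen_ne_zero Lc lev n (hrs 0)) Mc hMc ρN LNc (scaleK σ σ (ANs R (ΨL R) (n + 1))) hA hAs fN hEAN hLN a w μ hfa' c
    (fun v => (P * W₀)⁻¹ *ᵥ (P *ᵥ hv v)) hθ lv hlve s

end Record

end Summit.QuantumFields.BalabanUV.Beta.FP.TowerDoorGaugePeriodisedGS

end
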